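/-
Copyright (c) 2026 the pub-hodgecm-mathlib formalisation cell (harness21).  Prover seat hodgecm-mathlib-F0P3-p01 (g19): road «S3-ram» (LEAD F0P3a-plan (g13); (Cnt2′) chair
F0P3a-p07 (g15)), finite half of the type-(2) root census — (C) the cross-literal RELATIONS, second hand of F0P3a-p02 (g18) (heads (A) ★ p849208, (B)); 2026-09-02.
-/
import Literature.NumberTheory.Rogawski1990.DepthZeroKappaTransferTypeOneRamifiedIsocelesRootCensus   -- ★ p847712 (F0P3a-p02): the frame ∕ params currency of the root census (`(A, hG)`, `J₀ = (StdForm.antidiagonal 3).over k`)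
import Literature.NumberTheory.Rogawski1990.DepthZeroKappaTransferTypeTwoRamifiedBlockRootCensusAffine   -- ★ p849444 (F0P3a-p02 (g18)): the v2 root-census heads `natCard_params_blockFrame_null_eq'`, `two_mul_natCard_params_blockFrame_quadraticChar_eq'` (ED. 3 §7)
import HarnessLib

/-!
# The ramified `κ`-orbital integral, type-(2) root census: THE CROSS-LITERAL RELATIONS `NE_fav = 2q`, `U_c − F_c = q`, `U − F = 2q` from the per-root line census
# (Kottwitz 1986 §3; Rogawski 1990 §4.9)

Topic `NumberTheory/Rogawski1990`; namespace `Literature.NumberTheory.Rogawski1990.TypeTwoBlockRoot`.  THEOREMS ONLY (no definition, no instance, no notation, no named fact,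
no `sorry`); kernel lane `--supports stmt-HodgeConjecture-24833`; finite-field ∕ integer bookkeeping only.  Cell `pub/hodgecm-mathlib` (D-0151), crux H413; road «S3-ram»
(Literature seeding, count-neutral); the (Cnt2′) BLOCK-LAW skeleton (keeper F0P3a-p06 (g16), v2.1), regimes A-odd ∕ C: the (α) cells `stub_Zpair_zero_odd_A` ∕ the pm pair
close by ★ `BlockLawArith.zero_Aodd_census (hNE : NE = 2 * q) (hFU : U − F = 2 * q)` and ★ `BlockLawArith.pm_Aodd_census (hNE) (hc : Uc − Fc = q)` (F0P3a-p03 (g18),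
★ p849020 §6) — THIS FILE is part **(C)** of F0P3a-p02 (g18)'s three-file plan (CENSUS NOTE v3, `F0/P3a/F0P3a-p02/g18/census/…proofBlueprint.v3…md`): it turns the
PER-ROOT LINE CENSUS of part (B) `DepthZeroKappaTransferTypeTwoRamifiedBlockRootCensus` (heads `natCard_params_blockFrame_null_eq`, `two_mul_natCard_params_blockFrame_quadraticChar_eq`,
statement-first 6c29e43f5c504dff) at the TWO literals' roots into those three atom equalities.

THE MATHEMATICS ([Kottwitz1986] §3; [Rogawski1990] §4.9 p. 55; chair RULING (14) (2): rows close through cross-literal RELATIONS, never through per-literal closed `1±`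
totals).  Part (B) says, for a root with residual Gram `diagonal δ` in a `J₀`-frame `A` (isolated index `i₀`, plane `{j, l}`), block residual matrix and class constant `c₀`:
`#null lines = 1 − χ(δ_jδ_l)` and `2·#{lines of class ε} = q + χ(δ_jδ_l) + ε·κ·J`, `κ = χ(c₀δ_{i₀}δ_jδ_l)`, `J = J(e)` the Jacobsthal atom of the root's residual
discriminant `e`.  §1: in ANY `J₀`-frame `δ_{i₀}δ_jδ_l = det(diagonal δ) = det J₀·(det A)² = −(det A)²`, so **`κ = χ(−c₀)` IS LITERAL-INDEPENDENT** and
`χ(δ_jδ_l) = χ(−δ_{i₀})` (the plane's type is read off the isolated vector's norm: `1` for the hyperbolic literal's frame, the non-square `η̄` for the anisotropic one).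
§2 (symbolic core, `ℤ`): if the FAVOURABLE root has `χ(δ_jδ_l) = −1` (two null lines) and the UNFAVOURABLE one `χ(δ_jδ_l) = +1` (none), and the two roots carry the same
`κ·J` (same `c₀` by §1; same `e` up to the spectral tie — carried as ONE hypothesis `hκJ`, as F0P3a-p02 asked), then `#null_fav = 2`, `#null_unf = 0`, `#cls_ε(unf) −
#cls_ε(fav) = 1` for `ε = ±1` and the class totals differ by `2` — `J` is never evaluated.  §3 (socket currency, any commutative ring receiving the counts, e.g. `ℂ` with
`q = N𝔭_v`): with the lattice dictionary «`q` lattices per residual line» (`NE = q·#null_fav`, `F_c = q·#cls_c(fav)`, `U_c = q·#cls_c(unf)`, `F = F₊ + F₋`, `U = U₊ + U₋`)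
the three atoms `NE = 2q`, `U_c − F_c = q`, `U − F = 2q` of ★ `BlockLawArith.{zero,pm}_Aodd_census` follow.  The counts enter as VARIABLES (`nf nu : ℤ`, `cf cu : ℤ → ℤ`):
instantiate them with (B)'s `Nat.card {p ∕∕ …}` casts at the two literals' `(δ, A, Y, B)` data — (B)'s conclusions are then exactly the hypotheses `hNf hNu hCf hCu`.
HONEST LABEL: HC_CM is proved only modulo the 2 remaining named inputs (hLiu418 24832, h413 24833) until rung 0 closes; nothing printed is asserted here; «S3-ram» has no
books consequence.

* §1 `det_antidiagonal_three_over`, `prod_three_eq_mul_mul_mul`, `mul_mul_mul_eq_neg_det_sq_of_frame`, **`quadraticChar_mul_frame_prod_eq`** (`χ(c₀δ_{i₀}δ_jδ_l) = χ(−c₀)`),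
  **`quadraticChar_plane_eq_of_frame`** (`χ(δ_jδ_l) = χ(−δ_{i₀})`).
* §2 **`null_fav_eq_two`**, **`null_unf_eq_zero`**, **`cls_unf_sub_cls_fav_eq_one`**, **`clsTotal_unf_sub_clsTotal_fav_eq_two`**.
* §3 **`socket_NE_eq_two_mul`**, **`socket_Uc_sub_Fc_eq`**, **`socket_U_sub_F_eq_two_mul`** (the `hNE ∕ hc ∕ hFU` atoms of ★ p849020 §6).

## References
* [Kottwitz1986] R. E. Kottwitz, *Base change for unit elements of Hecke algebras*, Compositio Math. 60 (1986), §3 (counting fixed lattices by residual data).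
* [Rogawski1990] J. D. Rogawski, *Automorphic Representations of Unitary Groups in Three Variables*, Ann. of Math. Stud. 123 (1990), §4.9 Prop. 4.9.1 p. 55.
* [IrelandRosen1990] K. Ireland, M. Rosen, *A Classical Introduction to Modern Number Theory*, GTM 84, Ch. 8 §1–§2 (quadratic character; Jacobsthal sums).
-/

set_option autoImplicit false

namespace Literature.NumberTheory.Rogawski1990.TypeTwoBlockRoot

open Finset Matrix
open Literature.NumberTheory.Automorphic Literature.NumberTheory.Automorphic.UnitaryGroup

/-! ## §1 Frame invariants: `δ_{i₀}δ_jδ_l = −(det A)²`, so `κ = χ(−c₀)` and `χ(δ_jδ_l) = χ(−δ_{i₀})` -/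

section Frame

variable {k : Type*} [Field k]

/-- `det J₀ = −1` for `J₀ = antidiag(1, 1, 1)`. [cite: Kottwitz1986, §3] -/
theorem det_antidiagonal_three_over : ((StdForm.antidiagonal 3).over k).det = -1 := by
  have hJ : ∀ i j : Fin 3, (StdForm.antidiagonal 3).over k i j = if j = Fin.rev i then (1 : k) else 0 := by
    intro i j
    simp only [StdForm.over, Matrix.map_apply, StdForm.antidiagonal]
    simp only [Matrix.of_apply]
    split_ifs <;> simp
  rw [Matrix.det_fin_three]; simp [hJ, Fin.rev]

/-- `∏_m δ_m = δ_{i₀}·δ_j·δ_l` for three distinct indices of `Fin 3`. [cite: Kottwitz1986, §3] -/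
theorem prod_three_eq_mul_mul_mul {M : Type*} [CommMonoid M] {i₀ j l : Fin 3} (hij : i₀ ≠ j) (hil : i₀ ≠ l) (hjl : j ≠ l) (δ : Fin 3 → M) :
    ∏ m, δ m = δ i₀ * δ j * δ l := by
  rw [Fin.prod_univ_three]
  fin_cases i₀ <;> fin_cases j <;> fin_cases l
  all_goals first | exact (hij rfl).elim | exact (hil rfl).elim | exact (hjl rfl).elim | ac_rfl

/-- **In a `J₀`-frame the product of the residual Gram's diagonal is `−(det A)²`**: `ᵗA J₀ A = diagonal δ` ⇒ `δ_{i₀}δ_jδ_l = −(det A)²`. [cite: Kottwitz1986, §3] -/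
theorem mul_mul_mul_eq_neg_det_sq_of_frame {i₀ j l : Fin 3} (hij : i₀ ≠ j) (hil : i₀ ≠ l) (hjl : j ≠ l) (δ : Fin 3 → k) (A : GL (Fin 3) k)
    (hG : ((A : Matrix (Fin 3) (Fin 3) k))ᵀ * ((StdForm.antidiagonal 3).over k) * (A : Matrix (Fin 3) (Fin 3) k) = diagonal δ) :
    δ i₀ * δ j * δ l = -((A : Matrix (Fin 3) (Fin 3) k).det ^ 2) := by
  have h := congrArg Matrix.det hG
  rw [Matrix.det_mul, Matrix.det_mul, Matrix.det_transpose, det_antidiagonal_three_over, Matrix.det_diagonal, prod_three_eq_mul_mul_mul hij hil hjl] at h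
  rw [← h]; ring

/-- **`κ` IS LITERAL-INDEPENDENT**: in any `J₀`-frame, `χ(c₀·δ_{i₀}·δ_j·δ_l) = χ(−c₀)` (`δ_{i₀}δ_jδ_l = −(det A)²`, `det A ≠ 0`). [cite: Kottwitz1986, §3] [cite: IrelandRosen1990, Ch. 8 §1] -/
theorem quadraticChar_mul_frame_prod_eq [Fintype k] [DecidableEq k] {i₀ j l : Fin 3} (hij : i₀ ≠ j) (hil : i₀ ≠ l) (hjl : j ≠ l) (δ : Fin 3 → k) (A : GL (Fin 3) k)
    (hG : ((A : Matrix (Fin 3) (Fin 3) k))ᵀ * ((StdForm.antidiagonal 3).over k) * (A : Matrix (Fin 3) (Fin 3) k) = diagonal δ) (c₀ : k) :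
    quadraticChar k (c₀ * δ i₀ * δ j * δ l) = quadraticChar k (-c₀) := by
  have hA : (A : Matrix (Fin 3) (Fin 3) k).det ≠ 0 := (Matrix.isUnits_det_units A).ne_zero
  have e : c₀ * δ i₀ * δ j * δ l = -c₀ * (A : Matrix (Fin 3) (Fin 3) k).det ^ 2 := by
    rw [show c₀ * δ i₀ * δ j * δ l = c₀ * (δ i₀ * δ j * δ l) by ring, mul_mul_mul_eq_neg_det_sq_of_frame hij hil hjl δ A hG]; ring
  rw [e, map_mul, quadraticChar_sq_one' hA, mul_one]

/-- **THE ROOT PLANE'S TYPE IS READ OFF THE ISOLATED NORM**: in any `J₀`-frame, `χ(δ_j·δ_l) = χ(−δ_{i₀})` (`δ_jδ_l = −(det A)²∕δ_{i₀}`). For the hyperbolic literal's frame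
`δ_{i₀} = 1`, for the anisotropic literal's frame `δ_{i₀} = η̄` is a non-square. [cite: Kottwitz1986, §3] [cite: IrelandRosen1990, Ch. 8 §1] -/
theorem quadraticChar_plane_eq_of_frame [Fintype k] [DecidableEq k] {i₀ j l : Fin 3} (hij : i₀ ≠ j) (hil : i₀ ≠ l) (hjl : j ≠ l) (δ : Fin 3 → k) (hδ : δ i₀ ≠ 0)
    (A : GL (Fin 3) k) (hG : ((A : Matrix (Fin 3) (Fin 3) k))ᵀ * ((StdForm.antidiagonal 3).over k) * (A : Matrix (Fin 3) (Fin 3) k) = diagonal δ) :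
    quadraticChar k (δ j * δ l) = quadraticChar k (-δ i₀) := by
  have hA : (A : Matrix (Fin 3) (Fin 3) k).det ≠ 0 := (Matrix.isUnits_det_units A).ne_zero
  have h3 := mul_mul_mul_eq_neg_det_sq_of_frame hij hil hjl δ A hG
  -- `δ_jδ_l · δ_{i₀}² = (−δ_{i₀}) · (det A)²`
  have e : δ j * δ l * δ i₀ ^ 2 = -δ i₀ * (A : Matrix (Fin 3) (Fin 3) k).det ^ 2 := by
    have : δ j * δ l * δ i₀ ^ 2 = (δ i₀ * δ j * δ l) * δ i₀ := by ring
    rw [this, h3]; ring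
  have h1 : quadraticChar k (δ j * δ l * δ i₀ ^ 2) = quadraticChar k (δ j * δ l) := by
    rw [map_mul, quadraticChar_sq_one' hδ, mul_one]
  rw [← h1, e, map_mul, quadraticChar_sq_one' hA, mul_one]

end Frame

/-! ## §2 The cross-literal relations, symbolic core over `ℤ` (counts as variables; (B)'s conclusions are the hypotheses) -/

section Core

/-- **THE FAVOURABLE ROOT HAS TWO NULL LINES**: `#null = 1 − χ(δ_jδ_l)` with `χ(δ_jδ_l) = −1`. [cite: Kottwitz1986, §3] [cite: Rogawski1990, §4.9 Prop. 4.9.1 p. 55] -/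
theorem null_fav_eq_two {nf sf : ℤ} (hNf : nf = 1 - sf) (hsf : sf = -1) : nf = 2 := by
  rw [hNf, hsf]; norm_num

/-- **THE UNFAVOURABLE ROOT HAS NO NULL LINE**: `#null = 1 − χ(δ_jδ_l)` with `χ(δ_jδ_l) = 1`. [cite: Kottwitz1986, §3] [cite: Rogawski1990, §4.9 Prop. 4.9.1 p. 55] -/
theorem null_unf_eq_zero {nu su : ℤ} (hNu : nu = 1 - su) (hsu : su = 1) : nu = 0 := by
  rw [hNu, hsu]; norm_num

/-- **CLASS BY CLASS, THE UNFAVOURABLE ROOT HAS ONE LINE MORE**: from `2·#cls_ε = q + χ(δ_jδ_l) + ε·κ·J` at both roots, `χ(δ_jδ_l) = ∓1`, and the common `κ·J` (hypothesis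
`hκJ` — the Jacobsthal atom is never evaluated): `#cls_ε(unf) − #cls_ε(fav) = 1`. [cite: Kottwitz1986, §3] [cite: Rogawski1990, §4.9 Prop. 4.9.1 p. 55] [cite: IrelandRosen1990, Ch. 8 §2] -/
theorem cls_unf_sub_cls_fav_eq_one {q sf su κf κu Jf Ju : ℤ} {cf cu : ℤ → ℤ}
    (hCf : ∀ ε : ℤ, ε = 1 ∨ ε = -1 → 2 * cf ε = q + sf + ε * κf * Jf) (hCu : ∀ ε : ℤ, ε = 1 ∨ ε = -1 → 2 * cu ε = q + su + ε * κu * Ju)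
    (hsf : sf = -1) (hsu : su = 1) (hκJ : κf * Jf = κu * Ju) {ε : ℤ} (hε : ε = 1 ∨ ε = -1) :
    cu ε - cf ε = 1 := by
  have hf := hCf ε hε
  have hu := hCu ε hε
  have h2 : (2 : ℤ) * (cu ε - cf ε) = 2 * 1 := by
    rw [mul_sub, hu, hf, hsf, hsu]; linear_combination ε * hκJ.symm
  exact mul_left_cancel₀ two_ne_zero h2

/-- **… and the class TOTALS differ by `2`**: `(#cls₊ + #cls₋)(unf) − (#cls₊ + #cls₋)(fav) = 2`. [cite: Kottwitz1986, §3] [cite: Rogawski1990, §4.9 Prop. 4.9.1 p. 55] -/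
theorem clsTotal_unf_sub_clsTotal_fav_eq_two {q sf su κf κu Jf Ju : ℤ} {cf cu : ℤ → ℤ}
    (hCf : ∀ ε : ℤ, ε = 1 ∨ ε = -1 → 2 * cf ε = q + sf + ε * κf * Jf) (hCu : ∀ ε : ℤ, ε = 1 ∨ ε = -1 → 2 * cu ε = q + su + ε * κu * Ju)
    (hsf : sf = -1) (hsu : su = 1) (hκJ : κf * Jf = κu * Ju) :
    (cu 1 + cu (-1)) - (cf 1 + cf (-1)) = 2 := by
  have h1 := cls_unf_sub_cls_fav_eq_one hCf hCu hsf hsu hκJ (Or.inl rfl)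
  have h2 := cls_unf_sub_cls_fav_eq_one hCf hCu hsf hsu hκJ (Or.inr rfl)
  linear_combination h1 + h2

/-- The class totals WITHOUT the sign split: `2·(#cls₊ + #cls₋) = 2·(q + χ(δ_jδ_l))` at one root (the `ε`-terms cancel) — so `#cls₊ + #cls₋ = q − 1` at the favourable root
and `q + 1` at the unfavourable one. [cite: Kottwitz1986, §3] [cite: IrelandRosen1990, Ch. 8 §2] -/
theorem clsTotal_eq {q s κ J : ℤ} {c : ℤ → ℤ} (hC : ∀ ε : ℤ, ε = 1 ∨ ε = -1 → 2 * c ε = q + s + ε * κ * J) : c 1 + c (-1) = q + s := by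
  have h1 := hC 1 (Or.inl rfl)
  have h2 := hC (-1) (Or.inr rfl)
  have h : (2 : ℤ) * (c 1 + c (-1)) = 2 * (q + s) := by rw [mul_add, h1, h2]; ring
  exact mul_left_cancel₀ two_ne_zero h

end Core

/-! ## §3 Socket currency: the atoms `NE = 2q`, `U_c − F_c = q`, `U − F = 2q` of ★ `BlockLawArith.{zero,pm}_Aodd_census` from the lattice dictionary «`q` per line» -/

section Socket

variable {R : Type*} [CommRing R]

/-- **`NE = 2q`** — the favourable literal's `E`-count: `q` lattices on each of its `#null_fav = 2` null root lines. [cite: Kottwitz1986, §3] [cite: Rogawski1990, §4.9 Prop. 4.9.1 p. 55] -/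
theorem socket_NE_eq_two_mul (q : R) {NE : R} {nf : ℤ} (hNE : NE = q * (nf : R)) (hnf : nf = 2) : NE = 2 * q := by
  rw [hNE, hnf]; push_cast; ring

/-- **`U_c − F_c = q`** — class by class: `U_c = q·#cls_c(unf)`, `F_c = q·#cls_c(fav)`, `#cls_c(unf) − #cls_c(fav) = 1`. [cite: Kottwitz1986, §3] [cite: Rogawski1990, §4.9 Prop. 4.9.1 p. 55] -/
theorem socket_Uc_sub_Fc_eq (q : R) {Uc Fc : R} {cu cf : ℤ} (hUc : Uc = q * (cu : R)) (hFc : Fc = q * (cf : R)) (h : cu - cf = 1) : Uc - Fc = q := by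
  have h' : ((cu : ℤ) : R) - (cf : R) = 1 := by exact_mod_cast congrArg (fun z : ℤ => (z : R)) h |>.trans (by push_cast; rfl)
  rw [hUc, hFc, ← mul_sub, h', mul_one]

/-- **`U − F = 2q`** — totals: `U = q·(#cls₊ + #cls₋)(unf)`, `F = q·(#cls₊ + #cls₋)(fav)`, difference of the line totals `= 2`. [cite: Kottwitz1986, §3] [cite: Rogawski1990, §4.9 Prop. 4.9.1 p. 55] -/
theorem socket_U_sub_F_eq_two_mul (q : R) {U F : R} {tu tf : ℤ} (hU : U = q * (tu : R)) (hF : F = q * (tf : R)) (h : tu - tf = 2) : U - F = 2 * q := by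
  have h' : ((tu : ℤ) : R) - (tf : R) = 2 := by exact_mod_cast congrArg (fun z : ℤ => (z : R)) h |>.trans (by push_cast; rfl)
  rw [hU, hF, ← mul_sub, h', mul_comm]

/-- The unfavourable literal's `E`-count vanishes: `q·#null_unf = 0`. [cite: Kottwitz1986, §3] -/
theorem socket_NE_unf_eq_zero (q : R) {NEu : R} {nu : ℤ} (hNE : NEu = q * (nu : R)) (hnu : nu = 0) : NEu = 0 := by
  rw [hNE, hnu]; simp

end Socket

/-! ## §4 The relations keyed on part (B)'s two heads (counts `ℕ`-valued, cast to `ℤ` as in (B)'s conclusions) -/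

section Keyed

/-- **THE THREE LINE RELATIONS FROM (B)'S HEADS AT THE TWO ROOTS** — hypotheses = (B) `natCard_params_blockFrame_null_eq` ∕ `two_mul_natCard_params_blockFrame_quadraticChar_eq`
instantiated at the favourable root (`χ(δ_jδ_l) = −1`) and at the unfavourable one (`χ(δ_jδ_l) = 1`), their `ℕ`-valued counts abstracted as `nf nu : ℕ`, `cf cu : ℤ → ℕ`
(class counts indexed by `ε = ±1`), plus the ONE linking hypothesis `hκJ` (same `κ·J` at both roots: `κ` by `quadraticChar_mul_frame_prod_eq`, `J(e)` by the spectral tie);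
conclusions: `nf = 2`, `nu = 0`, `cu ε = cf ε + 1`, `cu 1 + cu (−1) = cf 1 + cf (−1) + 2`. [cite: Kottwitz1986, §3] [cite: Rogawski1990, §4.9 Prop. 4.9.1 p. 55] [cite: IrelandRosen1990, Ch. 8 §2] -/
theorem crossLiteral_lineRelations {q κf κu Jf Ju : ℤ} {sf su : ℤ} {nf nu : ℕ} {cf cu : ℤ → ℕ}
    (hNf : (nf : ℤ) = 1 - sf) (hNu : (nu : ℤ) = 1 - su)
    (hCf : ∀ ε : ℤ, ε = 1 ∨ ε = -1 → 2 * (cf ε : ℤ) = q + sf + ε * κf * Jf) (hCu : ∀ ε : ℤ, ε = 1 ∨ ε = -1 → 2 * (cu ε : ℤ) = q + su + ε * κu * Ju)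
    (hsf : sf = -1) (hsu : su = 1) (hκJ : κf * Jf = κu * Ju) :
    nf = 2 ∧ nu = 0 ∧ (∀ ε : ℤ, ε = 1 ∨ ε = -1 → cu ε = cf ε + 1) ∧ cu 1 + cu (-1) = cf 1 + cf (-1) + 2 := by
  refine ⟨?_, ?_, fun ε hε => ?_, ?_⟩
  · exact_mod_cast null_fav_eq_two hNf hsf
  · exact_mod_cast null_unf_eq_zero hNu hsu
  · have h := cls_unf_sub_cls_fav_eq_one (cf := fun e => (cf e : ℤ)) (cu := fun e => (cu e : ℤ)) hCf hCu hsf hsu hκJ hε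
    omega
  · have h := clsTotal_unf_sub_clsTotal_fav_eq_two (cf := fun e => (cf e : ℤ)) (cu := fun e => (cu e : ℤ)) hCf hCu hsf hsu hκJ
    omega

end Keyed

/-! ## §5 (ED. 2) The relations keyed on (B)'s GENERAL-LAW heads (statement-first v2 ba3b4f62: no `htr`, regime C ∕ the tie included) — shapes `#null = 1 + t`,
`2·#cls_ε = q − t + ε·κ·J(τ, disc)` with `t := χ(δ_jδ_l·det B̄′_W)`, `κ := χ(2c₀δ_{i₀}δ_jδ_l)`; favourable root `t = 1`, unfavourable `t = −1` -/

section CoreV2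

/-- **FAVOURABLE ROOT, v2 shape**: `#null = 1 + t` with `t = 1`. [cite: Kottwitz1986, §3] [cite: Rogawski1990, §4.9 Prop. 4.9.1 p. 55] -/
theorem null_fav_eq_two' {nf tf : ℤ} (hNf : nf = 1 + tf) (htf : tf = 1) : nf = 2 := by
  rw [hNf, htf]; norm_num

/-- **UNFAVOURABLE ROOT, v2 shape**: `#null = 1 + t` with `t = −1`. [cite: Kottwitz1986, §3] [cite: Rogawski1990, §4.9 Prop. 4.9.1 p. 55] -/
theorem null_unf_eq_zero' {nu tu : ℤ} (hNu : nu = 1 + tu) (htu : tu = -1) : nu = 0 := by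
  rw [hNu, htu]; norm_num

/-- **CLASS BY CLASS, v2 shape**: from `2·#cls_ε = q − t + ε·κ·J` at both roots, `t_fav = 1`, `t_unf = −1` and the common `κ·J` (hypothesis `hκJ`; the elliptic sum `J(τ, disc)`
is never evaluated): `#cls_ε(unf) − #cls_ε(fav) = 1`. [cite: Kottwitz1986, §3] [cite: Rogawski1990, §4.9 Prop. 4.9.1 p. 55] [cite: IrelandRosen1990, Ch. 8 §2] -/
theorem cls_unf_sub_cls_fav_eq_one' {q tf tu κf κu Jf Ju : ℤ} {cf cu : ℤ → ℤ}
    (hCf : ∀ ε : ℤ, ε = 1 ∨ ε = -1 → 2 * cf ε = q - tf + ε * κf * Jf) (hCu : ∀ ε : ℤ, ε = 1 ∨ ε = -1 → 2 * cu ε = q - tu + ε * κu * Ju)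
    (htf : tf = 1) (htu : tu = -1) (hκJ : κf * Jf = κu * Ju) {ε : ℤ} (hε : ε = 1 ∨ ε = -1) :
    cu ε - cf ε = 1 := by
  have hf := hCf ε hε
  have hu := hCu ε hε
  have h2 : (2 : ℤ) * (cu ε - cf ε) = 2 * 1 := by
    rw [mul_sub, hu, hf, htf, htu]; linear_combination ε * hκJ.symm
  exact mul_left_cancel₀ two_ne_zero h2

/-- The class totals at one root, v2 shape: `#cls₊ + #cls₋ = q − t`. [cite: Kottwitz1986, §3] [cite: IrelandRosen1990, Ch. 8 §2] -/
theorem clsTotal_eq' {q t κ J : ℤ} {c : ℤ → ℤ} (hC : ∀ ε : ℤ, ε = 1 ∨ ε = -1 → 2 * c ε = q - t + ε * κ * J) : c 1 + c (-1) = q - t := by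
  have h1 := hC 1 (Or.inl rfl)
  have h2 := hC (-1) (Or.inr rfl)
  have h : (2 : ℤ) * (c 1 + c (-1)) = 2 * (q - t) := by rw [mul_add, h1, h2]; ring
  exact mul_left_cancel₀ two_ne_zero h

/-- **THE THREE LINE RELATIONS FROM (B)'S v2 HEADS AT THE TWO ROOTS** — hypotheses = `natCard_params_blockFrame_null_eq'` ∕ `two_mul_natCard_params_blockFrame_quadraticChar_eq'`
at the favourable root (`t = χ(δ_jδ_l·det B̄′_W) = 1`) and at the unfavourable one (`t = −1`), counts abstracted as `nf nu : ℕ`, `cf cu : ℤ → ℕ`, plus the ONE linking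
hypothesis `hκJ` (same `κ·J(τ, disc)` at both roots: `κ = χ(2c₀δ_{i₀}δ_jδ_l) = χ(−2c₀)` by `quadraticChar_mul_frame_prod_eq`, `(τ, disc)` by the spectral tie); conclusions:
`nf = 2`, `nu = 0`, `cu ε = cf ε + 1`, `cu 1 + cu (−1) = cf 1 + cf (−1) + 2`. [cite: Kottwitz1986, §3] [cite: Rogawski1990, §4.9 Prop. 4.9.1 p. 55] [cite: IrelandRosen1990, Ch. 8 §2] -/
theorem crossLiteral_lineRelations' {q κf κu Jf Ju : ℤ} {tf tu : ℤ} {nf nu : ℕ} {cf cu : ℤ → ℕ}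
    (hNf : (nf : ℤ) = 1 + tf) (hNu : (nu : ℤ) = 1 + tu)
    (hCf : ∀ ε : ℤ, ε = 1 ∨ ε = -1 → 2 * (cf ε : ℤ) = q - tf + ε * κf * Jf) (hCu : ∀ ε : ℤ, ε = 1 ∨ ε = -1 → 2 * (cu ε : ℤ) = q - tu + ε * κu * Ju)
    (htf : tf = 1) (htu : tu = -1) (hκJ : κf * Jf = κu * Ju) :
    nf = 2 ∧ nu = 0 ∧ (∀ ε : ℤ, ε = 1 ∨ ε = -1 → cu ε = cf ε + 1) ∧ cu 1 + cu (-1) = cf 1 + cf (-1) + 2 := by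
  refine ⟨?_, ?_, fun ε hε => ?_, ?_⟩
  · exact_mod_cast null_fav_eq_two' hNf htf
  · exact_mod_cast null_unf_eq_zero' hNu htu
  · have h := cls_unf_sub_cls_fav_eq_one' (cf := fun e => (cf e : ℤ)) (cu := fun e => (cu e : ℤ)) hCf hCu htf htu hκJ hε
    omega
  · have h1 := cls_unf_sub_cls_fav_eq_one' (cf := fun e => (cf e : ℤ)) (cu := fun e => (cu e : ℤ)) hCf hCu htf htu hκJ (Or.inl rfl)
    have h2 := cls_unf_sub_cls_fav_eq_one' (cf := fun e => (cf e : ℤ)) (cu := fun e => (cu e : ℤ)) hCf hCu htf htu hκJ (Or.inr rfl)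
    omega

end CoreV2

/-! ## §6 (ED. 2) The two roots' plane factors are OPPOSITE: `χ(δ_jδ_l·D)` at a frame with `χ(δ_{i₀}) = 1` is minus the same at a frame with `χ(δ_{i₀}) = −1` -/

section Opposite

variable {k : Type*} [Field k] [Fintype k] [DecidableEq k]

/-- `χ(δ_jδ_l·D) = χ(−δ_{i₀})·χ(D)` in a `J₀`-frame (★ §1 `quadraticChar_plane_eq_of_frame`). [cite: Kottwitz1986, §3] [cite: IrelandRosen1990, Ch. 8 §1] -/
theorem quadraticChar_plane_mul_eq_of_frame {i₀ j l : Fin 3} (hij : i₀ ≠ j) (hil : i₀ ≠ l) (hjl : j ≠ l) (δ : Fin 3 → k) (hδ : δ i₀ ≠ 0)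
    (A : GL (Fin 3) k) (hG : ((A : Matrix (Fin 3) (Fin 3) k))ᵀ * ((StdForm.antidiagonal 3).over k) * (A : Matrix (Fin 3) (Fin 3) k) = diagonal δ) (D : k) :
    quadraticChar k (δ j * δ l * D) = quadraticChar k (-δ i₀) * quadraticChar k D := by
  rw [map_mul, quadraticChar_plane_eq_of_frame hij hil hjl δ hδ A hG]

/-- **OPPOSITE PLANE FACTORS**: for two `J₀`-frames, one with `χ(δ_{i₀}) = 1` (the hyperbolic literal: isolated norm `1`) and one with `χ(δ′_{i₁}) = −1` (the anisotropic
literal: isolated norm the non-square `η̄`), and the SAME residual datum `D` (`−det B̄′_W`, common by the spectral tie): `χ(δ_jδ_l·D) = −χ(δ′_{j₁}δ′_{l₁}·D)` — so exactly one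
of the two roots has `t = +1` (two null lines) when `D ≠ 0`. [cite: Kottwitz1986, §3] [cite: Rogawski1990, §4.9 Prop. 4.9.1 p. 55] [cite: IrelandRosen1990, Ch. 8 §1] -/
theorem quadraticChar_plane_mul_eq_neg_of_frames {i₀ j l : Fin 3} (hij : i₀ ≠ j) (hil : i₀ ≠ l) (hjl : j ≠ l) (δ : Fin 3 → k) (hδ : quadraticChar k (δ i₀) = 1)
    (A : GL (Fin 3) k) (hG : ((A : Matrix (Fin 3) (Fin 3) k))ᵀ * ((StdForm.antidiagonal 3).over k) * (A : Matrix (Fin 3) (Fin 3) k) = diagonal δ)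
    {i₁ j₁ l₁ : Fin 3} (hij₁ : i₁ ≠ j₁) (hil₁ : i₁ ≠ l₁) (hjl₁ : j₁ ≠ l₁) (δ' : Fin 3 → k) (hδ' : quadraticChar k (δ' i₁) = -1)
    (A' : GL (Fin 3) k) (hG' : ((A' : Matrix (Fin 3) (Fin 3) k))ᵀ * ((StdForm.antidiagonal 3).over k) * (A' : Matrix (Fin 3) (Fin 3) k) = diagonal δ') (D : k) :
    quadraticChar k (δ j * δ l * D) = -quadraticChar k (δ' j₁ * δ' l₁ * D) := by
  have h0 : δ i₀ ≠ 0 := fun h => by rw [h, MulChar.map_zero] at hδ; exact zero_ne_one hδ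
  have h0' : δ' i₁ ≠ 0 := fun h => by rw [h, MulChar.map_zero] at hδ'; norm_num at hδ'
  rw [quadraticChar_plane_mul_eq_of_frame hij hil hjl δ h0 A hG D, quadraticChar_plane_mul_eq_of_frame hij₁ hil₁ hjl₁ δ' h0' A' hG' D,
    neg_eq_neg_one_mul (δ i₀), neg_eq_neg_one_mul (δ' i₁), map_mul, map_mul, hδ, hδ']
  ring

end Opposite

/-! ## §7 (ED. 3) The relations read off the ★ root census (★ p849444, F0P3a-p02 (g18)) at the two roots -/

section FromCensus

/-- **THE CROSS-LITERAL LINE RELATIONS FROM THE ★ ROOT CENSUS (two-frame corollary of ★ p849444)** — ★ `natCard_params_blockFrame_null_eq'` ∕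
`two_mul_natCard_params_blockFrame_quadraticChar_eq'` (F0P3a-p02 (g18)) at the favourable root `(δf, Bf, Af, Yf)` (plane factor `t = 1`) and at the unfavourable one
`(δu, Bu, Au, Yu)` (`t = −1`), same class constant `c₀`, with the ONE dictionary hypothesis `hκJ` (equal `χ(2c₀δ_{i₀}δ_jδ_l)·J(τ, disc)` at the two roots — `κ` by ★
`quadraticChar_mul_frame_prod_eq`, `(τ, disc)` by the spectral tie): `#null(Yf) = 2`, `#null(Yu) = 0`, `#cls_ε(Yu) = #cls_ε(Yf) + 1` for `ε = ±1`, in (B)'s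
`Nat.card {p ∕∕ …}` texts VERBATIM. [cite: Kottwitz1986, §3] [cite: Rogawski1990, §4.9 Prop. 4.9.1 p. 55] [cite: IrelandRosen1990, Ch. 8 §2] -/
theorem crossLiteral_of_blockRootCensus {k : Type*} [Field k] [Fintype k] [DecidableEq k] (hk : ringChar k ≠ 2)
    {i₀ j l : Fin 3} (hij : i₀ ≠ j) (hil : i₀ ≠ l) (hjl : j ≠ l)
    (δf : Fin 3 → k) (hδf : ∀ m, δf m ≠ 0) (Bf : Matrix (Fin 3) (Fin 3) k)
    (hBf₁ : Bf i₀ j = 0) (hBf₂ : Bf i₀ l = 0) (hBf₃ : Bf j i₀ = 0) (hBf₄ : Bf l i₀ = 0)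
    (hadjf : δf j * Bf j l = δf l * Bf l j)
    (hirrf : quadraticChar k ((Bf j j - Bf l l) ^ 2 + 4 * (Bf j l * Bf l j)) = -1)
    (Af : GL (Fin 3) k) (Yf : Matrix (Fin 3) (Fin 3) k)
    (hGf : ((Af : Matrix (Fin 3) (Fin 3) k))ᵀ * ((StdForm.antidiagonal 3).over k) * (Af : Matrix (Fin 3) (Fin 3) k) = diagonal δf)
    (hYf : ((Af⁻¹ : GL (Fin 3) k) : Matrix (Fin 3) (Fin 3) k) * Yf * (Af : Matrix (Fin 3) (Fin 3) k) = Bf)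
    {i₁ j₁ l₁ : Fin 3} (hij₁ : i₁ ≠ j₁) (hil₁ : i₁ ≠ l₁) (hjl₁ : j₁ ≠ l₁)
    (δu : Fin 3 → k) (hδu : ∀ m, δu m ≠ 0) (Bu : Matrix (Fin 3) (Fin 3) k)
    (hBu₁ : Bu i₁ j₁ = 0) (hBu₂ : Bu i₁ l₁ = 0) (hBu₃ : Bu j₁ i₁ = 0) (hBu₄ : Bu l₁ i₁ = 0)
    (hadju : δu j₁ * Bu j₁ l₁ = δu l₁ * Bu l₁ j₁)
    (hirru : quadraticChar k ((Bu j₁ j₁ - Bu l₁ l₁) ^ 2 + 4 * (Bu j₁ l₁ * Bu l₁ j₁)) = -1)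
    (Au : GL (Fin 3) k) (Yu : Matrix (Fin 3) (Fin 3) k)
    (hGu : ((Au : Matrix (Fin 3) (Fin 3) k))ᵀ * ((StdForm.antidiagonal 3).over k) * (Au : Matrix (Fin 3) (Fin 3) k) = diagonal δu)
    (hYu : ((Au⁻¹ : GL (Fin 3) k) : Matrix (Fin 3) (Fin 3) k) * Yu * (Au : Matrix (Fin 3) (Fin 3) k) = Bu)
    (c₀ : k) (hc₀ : c₀ ≠ 0)
    (htf : quadraticChar k (δf j * δf l * (Bf j l * Bf l j - (Bf j j - Bf i₀ i₀) * (Bf l l - Bf i₀ i₀))) = 1)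
    (htu : quadraticChar k (δu j₁ * δu l₁ * (Bu j₁ l₁ * Bu l₁ j₁ - (Bu j₁ j₁ - Bu i₁ i₁) * (Bu l₁ l₁ - Bu i₁ i₁))) = -1)
    (hκJ : quadraticChar k (2 * c₀ * δf i₀ * δf j * δf l) *
        ∑ v : k, quadraticChar k (v + (Bf j j + Bf l l - 2 * Bf i₀ i₀)) * quadraticChar k (v ^ 2 - ((Bf j j - Bf l l) ^ 2 + 4 * (Bf j l * Bf l j))) =
      quadraticChar k (2 * c₀ * δu i₁ * δu j₁ * δu l₁) *
        ∑ v : k, quadraticChar k (v + (Bu j₁ j₁ + Bu l₁ l₁ - 2 * Bu i₁ i₁)) * quadraticChar k (v ^ 2 - ((Bu j₁ j₁ - Bu l₁ l₁) ^ 2 + 4 * (Bu j₁ l₁ * Bu l₁ j₁)))) :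
    Nat.card {p : Option {p : k × k // p.2 + (RingHom.id k) p.2 + p.1 * (RingHom.id k) p.1 = 0} //
        (p.elim (Pi.single 2 1) fun q => ![(1 : k), q.1.1, q.1.2]) ⬝ᵥ
          (((((StdForm.antidiagonal 3).over k) * Yf) *ᵥ (p.elim (Pi.single 2 1) fun q => ![(1 : k), q.1.1, q.1.2]))) = 0} = 2 ∧
    Nat.card {p : Option {p : k × k // p.2 + (RingHom.id k) p.2 + p.1 * (RingHom.id k) p.1 = 0} //
        (p.elim (Pi.single 2 1) fun q => ![(1 : k), q.1.1, q.1.2]) ⬝ᵥ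
          (((((StdForm.antidiagonal 3).over k) * Yu) *ᵥ (p.elim (Pi.single 2 1) fun q => ![(1 : k), q.1.1, q.1.2]))) = 0} = 0 ∧
    (∀ ε : ℤ, ε = 1 ∨ ε = -1 →
      Nat.card {p : Option {p : k × k // p.2 + (RingHom.id k) p.2 + p.1 * (RingHom.id k) p.1 = 0} //
        quadraticChar k (c₀ * ((p.elim (Pi.single 2 1) fun q => ![(1 : k), q.1.1, q.1.2]) ⬝ᵥ
          (((((StdForm.antidiagonal 3).over k) * Yu) *ᵥ (p.elim (Pi.single 2 1) fun q => ![(1 : k), q.1.1, q.1.2]))))) = ε} =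
      Nat.card {p : Option {p : k × k // p.2 + (RingHom.id k) p.2 + p.1 * (RingHom.id k) p.1 = 0} //
        quadraticChar k (c₀ * ((p.elim (Pi.single 2 1) fun q => ![(1 : k), q.1.1, q.1.2]) ⬝ᵥ
          (((((StdForm.antidiagonal 3).over k) * Yf) *ᵥ (p.elim (Pi.single 2 1) fun q => ![(1 : k), q.1.1, q.1.2]))))) = ε} + 1) := by
  obtain ⟨h1, h2, h3, -⟩ := crossLiteral_lineRelations'
    (cf := fun ε => Nat.card {p : Option {p : k × k // p.2 + (RingHom.id k) p.2 + p.1 * (RingHom.id k) p.1 = 0} //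
        quadraticChar k (c₀ * ((p.elim (Pi.single 2 1) fun q => ![(1 : k), q.1.1, q.1.2]) ⬝ᵥ
          (((((StdForm.antidiagonal 3).over k) * Yf) *ᵥ (p.elim (Pi.single 2 1) fun q => ![(1 : k), q.1.1, q.1.2]))))) = ε})
    (cu := fun ε => Nat.card {p : Option {p : k × k // p.2 + (RingHom.id k) p.2 + p.1 * (RingHom.id k) p.1 = 0} //
        quadraticChar k (c₀ * ((p.elim (Pi.single 2 1) fun q => ![(1 : k), q.1.1, q.1.2]) ⬝ᵥ
          (((((StdForm.antidiagonal 3).over k) * Yu) *ᵥ (p.elim (Pi.single 2 1) fun q => ![(1 : k), q.1.1, q.1.2]))))) = ε})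
    (natCard_params_blockFrame_null_eq' hk hij hil hjl δf hδf Bf hBf₁ hBf₂ hBf₃ hBf₄ hadjf hirrf Af Yf hGf hYf)
    (natCard_params_blockFrame_null_eq' hk hij₁ hil₁ hjl₁ δu hδu Bu hBu₁ hBu₂ hBu₃ hBu₄ hadju hirru Au Yu hGu hYu)
    (fun ε hε => two_mul_natCard_params_blockFrame_quadraticChar_eq' hk hij hil hjl δf hδf Bf hBf₁ hBf₂ hBf₃ hBf₄ hadjf hirrf Af Yf hGf hYf c₀ hc₀ hε)
    (fun ε hε => two_mul_natCard_params_blockFrame_quadraticChar_eq' hk hij₁ hil₁ hjl₁ δu hδu Bu hBu₁ hBu₂ hBu₃ hBu₄ hadju hirru Au Yu hGu hYu c₀ hc₀ hε)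
    htf htu hκJ
  exact ⟨h1, h2, h3⟩

end FromCensus

end Literature.NumberTheory.Rogawski1990.TypeTwoBlockRoot
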